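import Summits.HodgeConjecture.HodgeConjecture.Theorems.MarkmanPartnerTransportK3Sq2OneCycleFifth
import Summits.HodgeConjecture.HodgeConjecture.Theorems.MarkmanPartnerTransportK3Sq2RealMultiplicationResidue

/-!
# Route MarkmanPartnerTransport · crux #5 `LowPicardRealMultiplication` BY NAME from a POSITIVE one-cycle
# clause: «a fourfold with genuine real multiplication carries one real-multiplication cycle»

`lowPicardRealMultiplication_of_oneCycleFifth` (`…K3Sq2OneCycleFifth`) reduces the route declaration
`LowPicardRealMultiplication` to a one-cycle clause stated under the crux's negative hypothesis
`¬ SpannedByIsometries X φ`. By `exists_realMultiplication_of_not_spannedByIsometries`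
(`…K3Sq2RealMultiplicationResidue`) that hypothesis hands the geometer POSITIVE data: a rational, type-preserving
endomorphism of `H²(X(ℂ); ℂ)` acting on the symplectic form by a real irrational number (genuine real
multiplication). This file restates the reduction with that datum as the hypothesis of the clause:

* `lowPicardRealMultiplication_of_realMultiplicationCycle` — **crux #5 BY NAME** from: «for every marked smooth
  projective `K3^{[2]}`-type `X` with `ρ(X) ≤ 3` carrying a rational type-preserving endomorphism with a real
  irrational eigenvalue on `σ`, there is ONE algebraic class `Z ∈ A⁴(X × X)` whose action `[Z]_*` (rational,
  type-preserving) has eigenvalue `ev` on `σ` with `deg minpoly_ℚ(ev) = k`, `k·j·m + ρ(X) ≠ 23` (`j ≥ 2`,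
  `m ≥ 3`)» — modulo {Verbitsky–Guan, O'Grady, `QInvAlgebraic`}; `…_of_charlesMarkman` modulo {Verbitsky–Guan,
  O'Grady, Charles–Markman 2013}.

CONDITIONAL on the displayed named facts; no definition, no sorry. Prover seat hodge-nonav-19652-p1 (gen 8),
`--supports stmt-HodgeConjecture-19653`. Nothing here proves the crux or HC.

References: E. Markman, Compos. Math. 160 (2024) Thm. 1.1; B. van Geemen, Michigan Math. J. 56 (2008) Lemma 3.2;
Yu. Zarhin, J. reine angew. Math. 341 (1983) Thm. 1.5.1, 1.6.
-/

noncomputable section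

set_option linter.dupNamespace false

open Module CategoryTheory MonoidalCategory Polynomial
open Literature.AlgebraicTopology.SingularHomology Literature.Geometry.Kaehler
open Literature.AlgebraicGeometry Literature.AlgebraicGeometry.Motives Literature.AlgebraicGeometry.HodgeTheory
open Literature.AlgebraicGeometry.Hyperkaehler Literature.AlgebraicGeometry.Surfaces
open Summit.HodgeConjecture.HodgeConjecture.Theorems.NikulinTwinTransport

namespace Summit.HodgeConjecture.HodgeConjecture.Theorems.MarkmanPartnerTransport.PartnerLattice

/-- `MarkedK3Sq[X, φ, P, z]`: VERBATIM the `let MarkedK3Sq := …` binder of the route declarations of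
MarkmanPartnerTransport (clauses (m1)–(m6)). Local notation only. -/
local notation3 (prettyPrint := false) "MarkedK3Sq[" X ", " φ ", " P ", " z "]" =>
  (((IsIntegralClass P ∧ ∀ Q : complexBetti X (2 * 4), IsIntegralClass Q → ∃ n : ℤ, Q = n • P) ∧
    (∀ c : complexBetti X 2, IsIntegralClass c ↔ ∃ v : K3HilbertIndex → ℤ, φ c = fun i => (v i : ℂ)) ∧
    (∀ a : complexBetti X 2, cupPowTwo a 4 = ((3 : ℂ) * (k3HilbertForm 2 (φ a) (φ a)) ^ 2) • P) ∧
    (IsOfHodgeType 4 X 2 2 0 (LinearEquiv.symm φ z) ∧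
      ∀ τ : complexBetti X 2, IsOfHodgeType 4 X 2 2 0 τ → ∃ t : ℂ, τ = t • LinearEquiv.symm φ z) ∧
    (∀ c : complexBetti X 2, IsOfHodgeType 4 X 2 1 1 c ↔
      (k3HilbertForm 2 (φ c) z = 0 ∧ k3HilbertForm 2 (φ c) (star z) = 0)) ∧
    (k3HilbertForm 2 z z = 0 ∧ 0 < (k3HilbertForm 2 (star z) z).re)))

/-- `RM[X, φ, z]`: «`X` has genuine real multiplication» — a rational, type-preserving endomorphism of
`H²(X(ℂ); ℂ)` acting on `σ = φ⁻¹ z` by a REAL IRRATIONAL number. Local notation only. -/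
local notation3 (prettyPrint := false) "RM[" X ", " φ ", " z "]" =>
  (∃ e : complexBetti X 2 →ₗ[ℂ] complexBetti X 2, (∀ y, IsRationalClass y → IsRationalClass (e y)) ∧
    (∀ (i j : ℕ) y, IsOfHodgeType 4 X 2 i j y → IsOfHodgeType 4 X 2 i j (e y)) ∧
    ∃ ev : ℂ, e (LinearEquiv.symm φ z) = ev • LinearEquiv.symm φ z ∧ ev.im = 0 ∧ ∀ a : ℚ, (a : ℂ) ≠ ev)

/-- `OneRMCycle[X, φ, z, hX]`: the positive one-cycle clause (degree form) — ONE algebraic class `Z ∈ A⁴(X × X)`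
whose action on `H²(X)` is rational, type-preserving, with eigenvalue `ev` on `σ`, `deg minpoly_ℚ(ev) = k`,
`k · j · m + ρ(X) ≠ 23`. Local notation only. -/
local notation3 (prettyPrint := false) "OneRMCycle[" X ", " φ ", " z ", " hX "]" =>
  (∃ (k : ℕ) (t : complexBetti X 2 →ₗ[ℂ] complexBetti X 2),
    (∀ j m : ℕ, 2 ≤ j → 3 ≤ m → k * j * m + Module.finrank ℂ ↥(algebraicClasses X 1) ≠ 23) ∧
    (∀ y, IsRationalClass y → IsRationalClass (t y)) ∧
    (∀ (a b : ℕ) y, IsOfHodgeType 4 X 2 a b y → IsOfHodgeType 4 X 2 a b (t y)) ∧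
    (∃ Z ∈ algebraicClasses (X ⊗ X) 4, ∀ y : complexBetti X 2,
      t y = corrAction complexOrientationFamily hX hX (rfl : 2 + 2 * 4 = 2 + 2 * 4) Z y) ∧
    ∃ ev : ℂ, t (LinearEquiv.symm φ z) = ev • LinearEquiv.symm φ z ∧ (minpoly ℚ ev).natDegree = k)

/-- **Crux #5 BY NAME from the positive one-cycle clause** (module docstring): if every marked smooth projective
`K3^{[2]}`-type `X` with `ρ(X) ≤ 3` and genuine real multiplication (`RM`) carries one real-multiplication
cycle (`OneRMCycle`), then `LowPicardRealMultiplication` holds, modulo {Verbitsky–Guan, O'Grady, `QInvAlgebraic`}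
(`¬ SpannedByIsometries ⇒ RM` by `exists_realMultiplication_of_not_spannedByIsometries`, then
`lowPicardRealMultiplication_of_oneCycleFifth`). [cite: Markman2024, §1.1 Thm. 1.1] [cite: Vangeemen2008, Lemma 3.2]
[cite: Zarhin1983HodgeGroupsK3, Thm. 1.5.1 and Thm. 1.6] -/
theorem lowPicardRealMultiplication_of_realMultiplicationCycle
    (hV : VerbitskyGuan_cohomology_K3HilbertSquareType) (hO : OGrady2008_dualBBFClass_algebraic) (hQ : QInvAlgebraic)
    (hOne : ∀ (X : SchemeOver ℂ) (hX : IsSmoothProjective 4 X), IsOfK3HilbertSquareType X →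
      ∀ (φ : complexBetti X 2 ≃ₗ[ℂ] (K3HilbertIndex → ℂ)) (P : complexBetti X (2 * 4)) (z : K3HilbertIndex → ℂ),
      MarkedK3Sq[X, φ, P, z] → Module.finrank ℂ ↥(algebraicClasses X 1) ≤ 3 → RM[X, φ, z] →
      OneRMCycle[X, φ, z, hX]) :
    Summit.HodgeConjecture.HodgeConjecture.Theses.MarkmanPartnerTransport.LowPicardRealMultiplication :=
  lowPicardRealMultiplication_of_oneCycleFifth hV hO hQ fun X hX hK φ P z hM hnsp hρ =>
    hOne X hX hK φ P z hM hρ (exists_realMultiplication_of_not_spannedByIsometries hX hM hnsp)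

/-- **Crux #5 BY NAME from the positive one-cycle clause, from the route's published facts** {Verbitsky–Guan,
O'Grady, Charles–Markman 2013} (`qInvAlgebraic_of_charlesMarkman`). CONDITIONAL; credits nothing; the crux stays
open (needed: the real-multiplication cycle). [cite: CharlesMarkman2013, Thm. 1.1 (§1)] [cite: Markman2024, §1.1 Thm. 1.1] -/
theorem lowPicardRealMultiplication_of_realMultiplicationCycle_of_charlesMarkman
    (hV : VerbitskyGuan_cohomology_K3HilbertSquareType) (hO : OGrady2008_dualBBFClass_algebraic)
    (hB : CharlesMarkman2013_lefschetzStandard_K3HilbertType)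
    (hOne : ∀ (X : SchemeOver ℂ) (hX : IsSmoothProjective 4 X), IsOfK3HilbertSquareType X →
      ∀ (φ : complexBetti X 2 ≃ₗ[ℂ] (K3HilbertIndex → ℂ)) (P : complexBetti X (2 * 4)) (z : K3HilbertIndex → ℂ),
      MarkedK3Sq[X, φ, P, z] → Module.finrank ℂ ↥(algebraicClasses X 1) ≤ 3 → RM[X, φ, z] →
      OneRMCycle[X, φ, z, hX]) :
    Summit.HodgeConjecture.HodgeConjecture.Theses.MarkmanPartnerTransport.LowPicardRealMultiplication :=
  lowPicardRealMultiplication_of_realMultiplicationCycle hV hO (qInvAlgebraic_of_charlesMarkman hV hB) hOne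

end Summit.HodgeConjecture.HodgeConjecture.Theorems.MarkmanPartnerTransport.PartnerLattice

end
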